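import Summits.QuantumFields.YangMills.Theorems.BalabanUVNodesK0RecordFormatNamesFluctD

/-!
# K0⁷ — EDITION 15e: PRINT's GRAPH COORDINATES over the non-`b₀` variables (ρZ-2, porter PT-A-1's `Z-NORMALISATION-v1.md` §3 ∕ `LZ-SPEC-v1.md` §1∕§4, the COMPUTATIONAL twin under the
# LETTER `RecordB0BlockInvertible`, CRIT-1 g34 02:19:22Z «a consumer road may [live under `Matrix.inv`], with the letter displayed»): `NonB0Idx ∕ blkToFluct ∕ recordLQtOff ∕ recordLQtBlk ∕
# recordXLoc ∕ recordCopLoc ∕ recordSBlk ∕ recordSkBlk ∕ recordPrecLoc ∕ recordPreckLoc ∕ recordZkLoc ∕ recordLogZkLoc ∕ recordZkkLoc ∕ recordLogZkkLoc`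

DEFINER seat `ym-nodeO-def-1` (gen 34); `--kind definition --supports stmt-QuantumFields-20541 --as helper`; count-neutral.  [I] = [Balaban1987RG1], [16] = [Balaban1985UVStability].

PRINT p.267–268: «LQ̃h = I … h is uniquely defined [local]», «Denoting the remaining variables by B we have … a linear parametrization B′ = CB of the space of solutions of Q̃B′ = 0».  In
the block form `LQ̃ = [A₁ A₂]` over `(b₀-coordinates) ⊕ (the remaining coordinates)` — `A₁ = recordLQtB0` (ed.15d), `A₂ = recordLQtOff` — the graph parametrisation is `C_loc = [−A₁⁻¹A₂; 1]`
(`Matrix.fromRows`, EXACTLY the shape of PT-A-1's `…PortS1ZkCoarea` §1 `fromCols A₁ A₂ * fromRows (−(A₁⁻¹A₂)) 1 = 0`), its index type `NonB0Idx` is GEOMETRIC and `Vk`-INDEPENDENT (the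
walk machinery of [16] (63) ∕ `B10LogDet63` needs that), and `recordZkLoc := |det A₁|⁻¹ · Z14 S_blk C_loc` is (1.4) by elimination (= `recordZkCan` by `…zCan_eq_zLoc` up to the block
reindexing `blkToFluct`, UNDER the letter; `Matrix.inv` is the nonsingular inverse — junk off the letter, SAID).  The quadratic form is carried to the block index by `Matrix.submatrix`
along the plain map `blkToFluct : CoarseIdx ⊕ NonB0Idx → FluctIdx` (`inl (c, j) ↦ (b₀(c), j)`, `inr i ↦ i`) — a bijection on the standing range (`centralBond_injective`), not needed as
such for the definitions.  Instances for the subtype `NonB0Idx` come from `Classical` (`open Classical in` at use sites; no `instance` declared here).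

WHAT THIS FILE IS (definitions only): §1 the block index and the blocks of `LQ̃`; §2 `C_loc`, the block-indexed forms `recordSBlk` (ed.15b's `Δ₁`∕𝒞 form `recordSΔ1`, the form the SPLIT
reads) and `recordSkBlk` (ed.15c's corrected (2.11) `recordSk₁`, representative-free), the preconditioned matrices `recordPrecLoc`∕`recordPreckLoc` (= the `T` of `B10LogDet63.matrix63`,
index `NonB0Idx`); §3 the elimination Gaussians `recordZkLoc`∕`recordZkkLoc` and logs.

HONEST FRAMING.  Definitions only; NOTHING of Bałaban is asserted, ported or discharged (not the letter, not positivity, not the walk representation); 27930⁸ OPEN; K0⁷∕K-Ax OPEN;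
NODE O 0∕1; COUNT 8∕28 · K 1∕4 UNMOVED; finite `𝕋⁴_{L^K}` at fixed ε — NOT continuum ∕ ℝ⁴ ∕ OS; **the Yang–Mills mass gap (Clay) is NOT proved by any of this.**  No `sorry`, `instance`,
`notation`; standard axioms.
-/

noncomputable section

open scoped BigOperators Matrix.Norms.L2Operator

namespace Summit.QuantumFields.YangMills.Theorems.K0RecordFormatNames

open Literature.MathematicalPhysics.QuantumFieldTheory.Balaban1983to89
open Literature.MathematicalPhysics.QuantumFieldTheory.Balaban1983to89.Node00
open Literature.MathematicalPhysics.QuantumFieldTheory.Balaban1983to89.T4Continuum (T4Family)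
open _root_.Matrix

variable (F : T4Family)

/-! ## §1  The non-`b₀` coordinates, the block reindexing, the blocks of `LQ̃` -/

/-- **`NonB0Idx` — «the remaining variables»**: the fluctuation coordinates NOT on a central bond `b₀(c)` (a `Vk`-independent, geometric index type). [cite: Balaban1987RG1, p.268] -/
abbrev NonB0Idx (k K : ℕ) : Type := {i : FluctIdx F k K // i.1 ∉ Set.range (recordB0 F k K)}

/-- **The block reindexing** `(b₀-coordinates) ⊕ (remaining) → all coordinates`: `inl (c, j) ↦ (b₀(c), j)`, `inr i ↦ i`. [cite: Balaban1987RG1, p.267–268 (bookkeeping)] -/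
def blkToFluct (k K : ℕ) : CoarseIdx F k K ⊕ NonB0Idx F k K → FluctIdx F k K :=
  Sum.elim (fun cj => (recordB0 F k K cj.1, cj.2)) (fun i => i.1)

/-- **`A₂ = recordLQtOff`** — `LQ̃` restricted to the remaining (non-`b₀`) coordinates. [cite: Balaban1987RG1, p.267–268] -/
def recordLQtOff (k K : ℕ) (Vk : GaugeField (F.P K) k (SU 2)) : Matrix (CoarseIdx F k K) (NonB0Idx F k K) ℝ :=
  fun cj i => recordLQtMat F k K Vk cj i.1

/-- **`LQ̃ = [A₁ A₂]`** in the block index (`Matrix.fromCols`). [cite: Balaban1987RG1, p.267] -/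
def recordLQtBlk (k K : ℕ) (Vk : GaugeField (F.P K) k (SU 2)) : Matrix (CoarseIdx F k K) (CoarseIdx F k K ⊕ NonB0Idx F k K) ℝ :=
  fromCols (recordLQtB0 F k K Vk) (recordLQtOff F k K Vk)

/-! ## §2  The graph parametrisation `C_loc = [−A₁⁻¹A₂; 1]`, the block-indexed forms, the preconditioned matrices -/

open Classical in
/-- **`X = A₁⁻¹A₂`** (nonsingular inverse; meaningful UNDER `RecordB0BlockInvertible`, junk `0`-inverse off it — SAID). [cite: Balaban1987RG1, p.267 («LQ̃h = I»)] -/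
def recordXLoc (k K : ℕ) (Vk : GaugeField (F.P K) k (SU 2)) : Matrix (CoarseIdx F k K) (NonB0Idx F k K) ℝ :=
  (recordLQtB0 F k K Vk)⁻¹ * recordLQtOff F k K Vk

open Classical in
/-- ★ **`C_loc = recordCopLoc := [−A₁⁻¹A₂; 1]`** — print's linear parametrisation `B′ = CB` of `{LQ̃B′ = 0}` by the remaining variables (`Matrix.fromRows`; `LQ̃·C_loc = 0` under the letter by
`…PortS1ZkCoarea.fromCols_mul_graphC`). [cite: Balaban1987RG1, p.268 («B′ = CB»)] -/
def recordCopLoc (k K : ℕ) (Vk : GaugeField (F.P K) k (SU 2)) : Matrix (CoarseIdx F k K ⊕ NonB0Idx F k K) (NonB0Idx F k K) ℝ :=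
  fromRows (-(recordXLoc F k K Vk)) 1

/-- **`S_blk`** — ed.15b's `Δ₁`∕𝒞-form matrix `recordSΔ1` carried to the block index along `blkToFluct`. [cite: Balaban1987RG1, (1.4)–(1.5) pp.260–261] -/
def recordSBlk (k K : ℕ) (εbg : ℝ) (U : GaugeField (F.P K) 0 (SU 2)) (Vk : GaugeField (F.P K) k (SU 2))
    (𝒞 : (FineIdx F K → ℝ) →ₗ[ℝ] (FineIdx F K → ℝ) →ₗ[ℝ] ℝ) (hopLin : (PBond (F.P K) (k + 1) → MatA 2) →ₗ[ℝ] (FluctIdx F k K → ℝ)) :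
    Matrix (CoarseIdx F k K ⊕ NonB0Idx F k K) (CoarseIdx F k K ⊕ NonB0Idx F k K) ℝ :=
  (recordSΔ1 F k K εbg U Vk 𝒞 hopLin).submatrix (blkToFluct F k K) (blkToFluct F k K)

/-- **`Sk_blk`** — ed.15c's corrected (2.11) matrix `recordSk₁` (representative-free) carried to the block index. [cite: Balaban1987RG1, (2.10)–(2.11) p.267] -/
def recordSkBlk (k K : ℕ) (εbg : ℝ) (Vk : GaugeField (F.P K) k (SU 2)) (hopLin : (PBond (F.P K) (k + 1) → MatA 2) →ₗ[ℝ] (FluctIdx F k K → ℝ)) :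
    Matrix (CoarseIdx F k K ⊕ NonB0Idx F k K) (CoarseIdx F k K ⊕ NonB0Idx F k K) ℝ :=
  (recordSk₁ F k K εbg Vk hopLin).submatrix (blkToFluct F k K) (blkToFluct F k K)

open Classical in
/-- ★ **`recordPrecLoc := C_locᵀ S_blk C_loc`** — the preconditioned matrix on the remaining variables (p.268 «C^{(k)} = (C*Δ^{(k)}C)⁻¹»; the `T` of `B10LogDet63.matrix63`, index `NonB0Idx`
geometric and `Vk`-independent — PT-A-1 LZ-SPEC §1).  Positivity NOT asserted. [cite: Balaban1987RG1, p.268; Balaban1985UVStability, (63) p.272] -/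
def recordPrecLoc (k K : ℕ) (εbg : ℝ) (U : GaugeField (F.P K) 0 (SU 2)) (Vk : GaugeField (F.P K) k (SU 2))
    (𝒞 : (FineIdx F K → ℝ) →ₗ[ℝ] (FineIdx F K → ℝ) →ₗ[ℝ] ℝ) (hopLin : (PBond (F.P K) (k + 1) → MatA 2) →ₗ[ℝ] (FluctIdx F k K → ℝ)) :
    Matrix (NonB0Idx F k K) (NonB0Idx F k K) ℝ :=
  (recordCopLoc F k K Vk)ᵀ * recordSBlk F k K εbg U Vk 𝒞 hopLin * recordCopLoc F k K Vk

open Classical in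
/-- **`recordPreckLoc := C_locᵀ Sk_blk C_loc`** — the same over the corrected (2.11) `Δ^{(k)}` (representative-free). [cite: Balaban1987RG1, p.268, (2.11) p.267] -/
def recordPreckLoc (k K : ℕ) (εbg : ℝ) (Vk : GaugeField (F.P K) k (SU 2)) (hopLin : (PBond (F.P K) (k + 1) → MatA 2) →ₗ[ℝ] (FluctIdx F k K → ℝ)) :
    Matrix (NonB0Idx F k K) (NonB0Idx F k K) ℝ :=
  (recordCopLoc F k K Vk)ᵀ * recordSkBlk F k K εbg Vk hopLin * recordCopLoc F k K Vk

/-! ## §3  The elimination Gaussians `|det A₁|⁻¹ · Z14 S_blk C_loc` and their logarithms -/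

open Classical in
/-- ★ **`recordZkLoc := |det A₁|⁻¹ · Z14 S_blk C_loc`** — (1.4) by elimination of the `b₀`-variables (print's road, p.268), over the `Δ₁`∕𝒞 form; = `recordZkCan` up to the block reindexing
by `…PortS1ZkCoarea.zCan_eq_zLoc` UNDER `RecordB0BlockInvertible`. [cite: Balaban1987RG1, (1.4) p.260, p.268] -/
def recordZkLoc (k K : ℕ) (εbg : ℝ) (U : GaugeField (F.P K) 0 (SU 2)) (Vk : GaugeField (F.P K) k (SU 2))
    (𝒞 : (FineIdx F K → ℝ) →ₗ[ℝ] (FineIdx F K → ℝ) →ₗ[ℝ] ℝ) (hopLin : (PBond (F.P K) (k + 1) → MatA 2) →ₗ[ℝ] (FluctIdx F k K → ℝ)) : ℝ :=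
  |(recordLQtB0 F k K Vk).det|⁻¹ * B12Eq15QuadraticForm.Z14 (recordSBlk F k K εbg U Vk 𝒞 hopLin) (recordCopLoc F k K Vk)

open Classical in
/-- **`log` of `recordZkLoc`.** [cite: Balaban1987RG1, (1.3)–(1.4) p.260, (2.12) p.267] -/
def recordLogZkLoc (k K : ℕ) (εbg : ℝ) (U : GaugeField (F.P K) 0 (SU 2)) (Vk : GaugeField (F.P K) k (SU 2))
    (𝒞 : (FineIdx F K → ℝ) →ₗ[ℝ] (FineIdx F K → ℝ) →ₗ[ℝ] ℝ) (hopLin : (PBond (F.P K) (k + 1) → MatA 2) →ₗ[ℝ] (FluctIdx F k K → ℝ)) : ℝ :=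
  Real.log (recordZkLoc F k K εbg U Vk 𝒞 hopLin)

open Classical in
/-- **`recordZkkLoc`** — the elimination Gaussian over the corrected (2.11) `Δ^{(k)}` (representative-free). [cite: Balaban1987RG1, (1.4) p.260, (2.11) p.267, p.268] -/
def recordZkkLoc (k K : ℕ) (εbg : ℝ) (Vk : GaugeField (F.P K) k (SU 2)) (hopLin : (PBond (F.P K) (k + 1) → MatA 2) →ₗ[ℝ] (FluctIdx F k K → ℝ)) : ℝ :=
  |(recordLQtB0 F k K Vk).det|⁻¹ * B12Eq15QuadraticForm.Z14 (recordSkBlk F k K εbg Vk hopLin) (recordCopLoc F k K Vk)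

open Classical in
/-- **`log` of `recordZkkLoc`.** [cite: Balaban1987RG1, (1.3)–(1.4) p.260, (2.11)–(2.12) p.267] -/
def recordLogZkkLoc (k K : ℕ) (εbg : ℝ) (Vk : GaugeField (F.P K) k (SU 2)) (hopLin : (PBond (F.P K) (k + 1) → MatA 2) →ₗ[ℝ] (FluctIdx F k K → ℝ)) : ℝ :=
  Real.log (recordZkkLoc F k K εbg Vk hopLin)

end Summit.QuantumFields.YangMills.Theorems.K0RecordFormatNames

end
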